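import Summits.BirchSwinnertonDyer.BirchSwinnertonDyer.Theorems.GenusKolyvaginAtTwoTorsionCellSELIsoClassSymbols
import Literature.NumberTheory.EllipticCurves.TwoDescentQuadraticTwistLocalConditions
import Literature.NumberTheory.EllipticCurves.TwoDescentSelmerBookkeeping
import HarnessLib

/-!
# SEL (iso-class Selmer pair law), II: the square-free kernel of a Selmer component of the iso-class twist `E^{(M)}`

Crux R″ `RankOneTwoTorsionResidualAtTwo` (stmt-27478), LINE 49 «full_vertex», SUPPORT stub SEL
`IsoClassSelmerPairLawAtTwo`, the `C₀ = E₀^{(M₀)}` half for a general iso-class set (memo #3 §3–§4 of pen bsd-idea-1,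
with the Greenberg–Wiles count replaced by explicit bookkeeping).  Setting: `E/ℚ` with rational `2`-torsion `a₁, a₂, a₃`
(`SplitTwoTorsion`, any labelling), `S` a finite set of primes off which the root differences are units, `Q` a finite set
of primes `≡ 3 (mod 4)` disjoint from `S` forming ONE square class at every `ℓ ∈ S` (`q ≡ q' (mod 8)`, `(qq'/ℓ) = 1`), and
the twist `E^{(M)}`, `M = ∏_{q∈Q} q`.

* **`exists_intKernel_of_mem_selmerGroup_twist_isoClass`** — a component `[a]` of a class `c ∈ Sel⁽²⁾(E^{(M)}/ℚ)` is
  `[m · ∏_{i ∈ m_a} i]` with `m_a = {i ∈ Q : v_i(a) odd}` (the `Q`-SUPPORT of the component) and `m ≠ 0` an `S`-supported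
  integer with the sign of `a`; the residue bit `η = qr_q(m)` is the SAME at every `q ∈ Q` (iso-class), and at a row prime
  `j ∈ Q`: `qr_j(a) = η + Σ_{i ∈ Q∖j} (1 + [−i/j])·v_i(a)` (bits in `𝔽₂`).

This is the `k`-prime analogue of `…D0TripleTwistKernel.exists_intKernel_of_mem_selmerGroup_twist_triple` (`k = 2`).
Everything is proved; no LINE 49 statement is restated; BSD is not advanced by this file alone.

## References

* [SilvermanAEC2009] J. H. Silverman, *The Arithmetic of Elliptic Curves*, 2nd ed., Prop. X.1.4, Prop. X.4.9.
* [Kane2013SelmerTwists] D. M. Kane, Algebra Number Theory 7 (2013), §2.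
* [HeathBrown1994SelmerCongruentII] D. R. Heath-Brown, Invent. Math. 118 (1994), §2.
-/

noncomputable section

open scoped Classical

namespace Summit.BirchSwinnertonDyer.BirchSwinnertonDyer.Theorems.GenusKolyvaginAtTwo.TorsionCellSEL

open WeierstrassCurve WeierstrassCurve.Affine WeierstrassCurve.Affine.Point
open Literature.NumberTheory.GaloisRepresentations Literature.NumberTheory.EllipticCurves Field
open Literature.NumberTheory.EllipticCurves.TwoDescentLocal
open Literature.NumberTheory.EllipticCurves.KramerTwoDescent
open Summit.BirchSwinnertonDyer.BirchSwinnertonDyer.Theorems.GenusKolyvaginAtTwo.TorsionCellD0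
open IsDedekindDomain NumberField Rat.HeightOneSpectrum

/-! ## Bookkeeping of `S ∪ Q`-supported kernels -/

section Bookkeeping

/-- An `S`-supported square-free kernel `ε ∏_{ℓ∈T} ℓ` as an integer. [folklore] -/
private theorem kernel_intCast {T : Finset ℕ} {ε : ℚ} (hε : ε = 1 ∨ ε = -1) :
    ∃ m : ℤ, (m : ℚ) = ε * ∏ ℓ ∈ T, (ℓ : ℚ) ∧ ∀ q : ℕ, q.Prime → q ∉ T → (∀ ℓ ∈ T, ℓ.Prime) → ¬ (q : ℤ) ∣ m := by
  have hεZ : ∃ e : ℤ, (e : ℚ) = ε ∧ (e = 1 ∨ e = -1) := by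
    rcases hε with h1 | h1
    · exact ⟨1, by rw [h1]; norm_num, Or.inl rfl⟩
    · exact ⟨-1, by rw [h1]; norm_num, Or.inr rfl⟩
  obtain ⟨e, he, he1⟩ := hεZ
  refine ⟨e * ∏ ℓ ∈ T, (ℓ : ℤ), by rw [← he]; push_cast; rfl, ?_⟩
  intro q hq hqT hTp hdvd
  have hqprime : Prime (q : ℤ) := Nat.prime_iff_prime_int.mp hq
  rcases hqprime.dvd_or_dvd hdvd with h1 | h2
  · rcases he1 with rfl | rfl
    · exact hq.one_lt.ne' (by exact_mod_cast Int.eq_one_of_dvd_one (by norm_num) h1)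
    · exact hq.one_lt.ne' (by exact_mod_cast Int.eq_one_of_dvd_one (by norm_num) (Int.dvd_neg.mpr h1))
  · obtain ⟨ℓ, hℓT, hℓ⟩ := (Prime.dvd_finsetProd_iff hqprime _).mp h2
    have := (Nat.prime_dvd_prime_iff_eq hq (hTp ℓ hℓT)).mp (by exact_mod_cast hℓ)
    exact hqT (this ▸ hℓT)

/-- Splitting a product over `T ⊆ S ∪ Q` (`Q` disjoint from `S`) into its `S`-part and its `Q`-part. [folklore] -/
private theorem prod_split {S Q T : Finset ℕ} (hQS : ∀ q ∈ Q, q ∉ S) (hT : T ⊆ S ∪ Q) {β : Type*} [CommMonoid β]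
    (f : ℕ → β) : ∏ ℓ ∈ T, f ℓ = (∏ ℓ ∈ T.filter (· ∈ S), f ℓ) * ∏ ℓ ∈ T.filter (· ∈ Q), f ℓ := by
  rw [← Finset.prod_filter_mul_prod_filter_not T (· ∈ S)]
  congr 1
  refine Finset.prod_congr ?_ fun _ _ => rfl
  ext ℓ
  simp only [Finset.mem_filter]
  constructor
  · rintro ⟨hℓT, hℓS⟩
    rcases Finset.mem_union.mp (hT hℓT) with h | h
    · exact absurd h hℓS
    · exact ⟨hℓT, h⟩
  · rintro ⟨hℓT, hℓQ⟩
    exact ⟨hℓT, hQS ℓ hℓQ⟩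

/-- A bit of `ℤ/2` is `0` or `1`. [folklore] -/
private theorem zmod2_cases (x : ZMod 2) : x = 0 ∨ x = 1 := by revert x; decide

end Bookkeeping

/-! ## The kernel of a Selmer component of `E^{(M)}` -/

section Kernel

variable (E : WeierstrassCurve ℚ) [E.IsElliptic] (S Q : Finset ℕ)

/-- **Square-free kernel of a component of a Selmer class of the iso-class twist `E^{(M)}`, `M = ∏_{q∈Q} q`.**  Let `E`
have rational `2`-torsion `a₁, a₂, a₃` with `a₁ − a₂`, `a₁ − a₃` units off the finite set of primes `S`, and let `Q` be a
finite set of primes `≡ 3 (mod 4)`, disjoint from `S`, pairwise in one square class at every `ℓ ∈ S`.  If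
`c ∈ Sel⁽²⁾(E^{(M)}/ℚ)` has `h`-component `[a]`, then `[a] = [m · ∏_{i∈m_a} i]` in `ℚˣ/ℚˣ²`, where
`m_a = {i ∈ Q : v_i(a) odd}` is the `Q`-support of the component and `m ≠ 0` is an integer all of whose prime factors lie
in `S`, with the sign of `a`; the residue bit `qr_q(m)` is the same at all `q ∈ Q`; and at every `j ∈ Q`,
`qr_j(a) = qr_j(m) + Σ_{i ∈ Q∖j} (1 + [−i/j])·v_i(a)`.  [cite: SilvermanAEC2009, Prop. X.1.4, Prop. X.4.9]
[cite: Kane2013SelmerTwists, §2] -/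
theorem exists_intKernel_of_mem_selmerGroup_twist_isoClass {a₁ a₂ a₃ : ℚ} (h : E.toAffine.SplitTwoTorsion a₁ a₂ a₃)
    (hS : ∀ ℓ ∈ S, ℓ.Prime)
    (hgood : ∀ ℓ : ℕ, (hℓ : ℓ.Prime) → ℓ ∉ S → haveI : Fact ℓ.Prime := ⟨hℓ⟩;
      padicValRat ℓ (a₁ - a₂) = 0 ∧ padicValRat ℓ (a₁ - a₃) = 0)
    (hQ : ∀ q ∈ Q, q.Prime) (hQS : ∀ q ∈ Q, q ∉ S) (hQ4 : ∀ q ∈ Q, q % 4 = 3)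
    (hiso8 : ∀ q ∈ Q, ∀ q' ∈ Q, q % 8 = q' % 8)
    (hisoS : ∀ q ∈ Q, ∀ q' ∈ Q, ∀ ℓ ∈ S, (hℓ : ℓ.Prime) → ℓ ≠ 2 → haveI : Fact ℓ.Prime := ⟨hℓ⟩;
      legendreSym ℓ ((q : ℤ) * q') = 1)
    {d : ℚ} (hd : d = ∏ q ∈ Q, (q : ℚ)) [(E.quadraticTwist d).IsElliptic]
    {c : galH1Torsion (E.quadraticTwist d) 2} (hc : c ∈ selmerGroup (E.quadraticTwist d) 2) (a : ℚˣ)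
    (ha : kummerEquiv ℚ 2 ((E.quadraticTwist d).twoTorsionCharH1 (h.quadraticTwist d) c) =
      Additive.ofMul (QuotientGroup.mk a)) :
    ∃ m : ℤ, (m : ℚ) ≠ 0 ∧ (∀ ℓ : ℕ, ℓ.Prime → ℓ ∉ S → ¬ (ℓ : ℤ) ∣ m) ∧ (0 < (m : ℚ) ↔ 0 < (a : ℚ)) ∧
      (∃ hg : (m : ℚ) * ∏ i ∈ Q.filter (fun i => parityBit i (a : ℚ) = 1), (i : ℚ) ≠ 0,
        (QuotientGroup.mk a : SqUnits ℚ) = QuotientGroup.mk (Units.mk0 _ hg)) ∧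
      (∀ q ∈ Q, ∀ q' ∈ Q, (hq : q.Prime) → (hq' : q'.Prime) →
        haveI : Fact q.Prime := ⟨hq⟩; haveI : Fact q'.Prime := ⟨hq'⟩; qrBit q (m : ℚ) = qrBit q' (m : ℚ)) ∧
      (∀ j ∈ Q, (hj : j.Prime) → haveI : Fact j.Prime := ⟨hj⟩;
        qrBit j (a : ℚ) = qrBit j (m : ℚ) +
          ∑ i ∈ Q.erase j, (1 + (if jacobiSym (-(i : ℤ)) j = -1 then (1 : ZMod 2) else 0)) * parityBit i (a : ℚ)) := by
  subst hd
  set d : ℚ := ∏ q ∈ Q, (q : ℚ) with hd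
  have h' := h.quadraticTwist d
  have hQ0 : ∀ q ∈ Q, (q : ℚ) ≠ 0 := fun q hq => by exact_mod_cast (hQ q hq).ne_zero
  have hd0 : d ≠ 0 := Finset.prod_ne_zero_iff.mpr hQ0
  -- kernel relative to `S' = S ∪ Q`
  set S' : Finset ℕ := S ∪ Q with hS'
  have hS'p : ∀ q ∈ S', q.Prime := fun q hq => by
    rcases Finset.mem_union.mp hq with hq | hq
    · exact hS q hq
    · exact hQ q hq
  have hgood' : ∀ ℓ : ℕ, (hℓ : ℓ.Prime) → ℓ ∉ S' → haveI : Fact ℓ.Prime := ⟨hℓ⟩;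
      padicValRat ℓ (d * a₁ - d * a₂) = 0 ∧ padicValRat ℓ (d * a₁ - d * a₃) = 0 := by
    intro ℓ hℓ hℓS'
    haveI : Fact ℓ.Prime := ⟨hℓ⟩
    have hℓS : ℓ ∉ S := fun h => hℓS' (Finset.mem_union_left Q h)
    have hℓQ : ℓ ∉ Q := fun h => hℓS' (Finset.mem_union_right S h)
    obtain ⟨g12, g13⟩ := hgood ℓ hℓ hℓS
    have hv : padicValRat ℓ d = 0 := by rw [hd, padicValRat_prod_primes hQ ℓ, if_neg hℓQ]
    exact ⟨by rw [← mul_sub, padicValRat.mul hd0 (sub_ne_zero.mpr h.ne₁₂), hv, g12, add_zero],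
      by rw [← mul_sub, padicValRat.mul hd0 (sub_ne_zero.mpr h.ne₁₃), hv, g13, add_zero]⟩
  obtain ⟨T, hTS', ε, hε, hεpos, hg, hmk, hpar, -⟩ :=
    (E.quadraticTwist d).exists_kernel_of_mem_selmerGroup h' S' hS'p hgood' hc a ha
  have hTp : ∀ ℓ ∈ T, ℓ.Prime := fun ℓ hℓ => hS'p ℓ (hTS' hℓ)
  have hε0 : ε ≠ 0 := by rcases hε with h1 | h1 <;> rw [h1] <;> norm_num
  -- the `S`-part of the kernel, as an integer
  have hT₀S : T.filter (· ∈ S) ⊆ S := fun ℓ hℓ => (Finset.mem_filter.mp hℓ).2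
  have hT₀p : ∀ ℓ ∈ T.filter (· ∈ S), ℓ.Prime := fun ℓ hℓ => hS ℓ (hT₀S hℓ)
  obtain ⟨m, hm, hmdiv⟩ := kernel_intCast (T := T.filter (· ∈ S)) hε
  have hprod0 : (0 : ℚ) < ∏ ℓ ∈ T.filter (· ∈ S), (ℓ : ℚ) :=
    Finset.prod_pos fun ℓ hℓ => by exact_mod_cast (hT₀p ℓ hℓ).pos
  have hm0 : (m : ℚ) ≠ 0 := by rw [hm]; exact mul_ne_zero hε0 hprod0.ne'
  -- the `Q`-part of the kernel is the `Q`-support of the component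
  have hQpart : T.filter (· ∈ Q) = Q.filter (fun i => parityBit i (a : ℚ) = 1) := by
    ext i
    simp only [Finset.mem_filter]
    constructor
    · rintro ⟨hiT, hiQ⟩
      haveI : Fact i.Prime := ⟨hQ i hiQ⟩
      exact ⟨hiQ, by rw [hpar i, if_pos hiT]⟩
    · rintro ⟨hiQ, hpi⟩
      haveI : Fact i.Prime := ⟨hQ i hiQ⟩
      have := hpar i
      rw [hpi] at this
      by_cases hiT : i ∈ T
      · exact ⟨hiT, hiQ⟩
      · rw [if_neg hiT] at this; exact absurd this one_ne_zero
  have hmaQ : Q.filter (fun i => parityBit i (a : ℚ) = 1) ⊆ Q := Finset.filter_subset _ _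
  have hker : ε * ∏ ℓ ∈ T, (ℓ : ℚ) = (m : ℚ) * ∏ i ∈ Q.filter (fun i => parityBit i (a : ℚ) = 1), (i : ℚ) := by
    rw [prod_split hQS hTS' (fun ℓ => (ℓ : ℚ)), ← mul_assoc, ← hm, hQpart]
  have hg' : (m : ℚ) * ∏ i ∈ Q.filter (fun i => parityBit i (a : ℚ) = 1), (i : ℚ) ≠ 0 := by rw [← hker]; exact hg
  -- the residue bit of `m` at `q ∈ Q` does not depend on `q`
  have hηconst : ∀ q ∈ Q, ∀ q' ∈ Q, (hq : q.Prime) → (hq' : q'.Prime) →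
      haveI : Fact q.Prime := ⟨hq⟩; haveI : Fact q'.Prime := ⟨hq'⟩; qrBit q (m : ℚ) = qrBit q' (m : ℚ) := by
    intro q hq q' hq' hqp hqp'
    haveI : Fact q.Prime := ⟨hqp⟩
    haveI : Fact q'.Prime := ⟨hqp'⟩
    rw [hm]
    exact qrBit_kernel_eq_of_isoClass S Q hS hQS hQ4 hiso8 hisoS hq hq' hT₀S hε
  refine ⟨m, hm0, fun ℓ hℓ hℓS => hmdiv ℓ hℓ (fun hT => hℓS (hT₀S hT)) hT₀p, ?_, ⟨hg', ?_⟩, hηconst, ?_⟩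
  · -- sign
    rw [← hεpos, hm]
    constructor
    · intro hpos
      rcases hε with h1 | h1
      · exact h1
      · rw [h1] at hpos; linarith
    · intro h1; rw [h1, one_mul]; exact hprod0
  · -- the class
    rw [hmk]; congr 1; exact Units.ext (by rw [Units.val_mk0, Units.val_mk0, hker])
  · -- the expansion of `qr_j(a)` at a row prime `j ∈ Q`
    intro j hj hjp
    haveI : Fact j.Prime := ⟨hjp⟩
    have hprodQ0 : ∏ i ∈ Q.filter (fun i => parityBit i (a : ℚ) = 1), (i : ℚ) ≠ 0 :=
      Finset.prod_ne_zero_iff.mpr fun i hi => hQ0 i (hmaQ hi)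
    rw [qrBit_eq_of_mk_eq j hmk, Units.val_mk0, hker, qrBit_mul j hm0 hprodQ0, qrBit_prod_natCast_eq Q hQ (hQ4 j hj) hmaQ]
    congr 1
    -- `#(m_a∖j) + Σ_{i∈m_a∖j} G j i = Σ_{i∈Q∖j} (1 + G j i)·v_i(a)`
    have hfilt : (Q.filter (fun i => parityBit i (a : ℚ) = 1)).erase j =
        (Q.erase j).filter (fun i => parityBit i (a : ℚ) = 1) := by
      ext i; simp only [Finset.mem_erase, Finset.mem_filter]; tauto
    rw [hfilt, Finset.card_eq_sum_ones, Nat.cast_sum, ← Finset.sum_add_distrib, Finset.sum_filter]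
    refine Finset.sum_congr rfl fun i hi => ?_
    rcases zmod2_cases (parityBit i (a : ℚ)) with h0 | h1
    · rw [h0, if_neg zero_ne_one, mul_zero]
    · rw [h1, if_pos rfl, mul_one, Nat.cast_one]

end Kernel

/-! ## The row relations at the primes of `Q` and the evenness of the `Q`-supports -/

section Rows

variable (E : WeierstrassCurve ℚ) [E.IsElliptic] {e₁ e₂ e₃ : ℚ} (S Q : Finset ℕ)

/-- `#(Q∖j) = 1` in `𝔽₂` for `#Q` even and `j ∈ Q`. [folklore] -/
private theorem card_erase_cast_eq_one {Q : Finset ℕ} (hk : Even Q.card) {j : ℕ} (hj : j ∈ Q) :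
    ((Q.erase j).card : ZMod 2) = 1 := by
  rw [Finset.card_erase_of_mem hj]
  obtain ⟨r, hr⟩ := hk
  have hpos : 0 < Q.card := Finset.card_pos.mpr ⟨j, hj⟩
  have : Q.card - 1 = 2 * (r - 1) + 1 := by omega
  rw [this, Nat.cast_add, Nat.cast_mul, show ((2 : ℕ) : ZMod 2) = 0 by decide, zero_mul, zero_add, Nat.cast_one]

/-- A sum of a constant over a set of even size vanishes in `𝔽₂`. [folklore] -/
private theorem sum_const_eq_zero_of_even {Q : Finset ℕ} (hk : Even Q.card) (x : ZMod 2) : ∑ _j ∈ Q, x = 0 := by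
  rw [Finset.sum_const, nsmul_eq_mul]
  obtain ⟨r, hr⟩ := hk
  rw [hr, ← two_mul, Nat.cast_mul, show ((2 : ℕ) : ZMod 2) = 0 by decide, zero_mul, zero_mul]

/-- **The ROW RELATIONS of a Selmer class of the iso-class twist and the EVENNESS of its `Q`-supports.**  Setting: `E/ℚ`
with rational `2`-torsion `e₁, e₂, e₃` whose differences are units off `S`; `Q` a finite set of primes `≡ 3 (mod 4)` of EVEN
size, disjoint from `S`, in one square class at every `ℓ ∈ S`, each FULL-ADMISSIBLE (`δ₁ = (e₁−e₂)(e₁−e₃)` and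
`δ₂ = (e₂−e₁)(e₂−e₃)` non-residues) and with the common bit `ε = qr_q(e₂ − e₁)`; `M = ∏_{q∈Q} q`.  For
`c ∈ Sel⁽²⁾(E^{(M)}/ℚ)` with components `([a],[b])` and `Q`-parity vectors `p_a = (v_i(a))_i`, `p_b`: there are bits
`η_a, η_b` (the residue bits of the `S`-kernels, constant on `Q`) with, at every `j ∈ Q` (`G j i = [−i/j]`,
`g_j = Σ_{i≠j} G j i`),
`Σ_{i≠j} G j i·p_a(i) + (g_j + ε)·p_a(j) + p_b(j) = η_a` and `Σ_{i≠j} G j i·p_b(i) + (g_j + ε + 1)·p_b(j) + p_a(j) = η_b`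
— i.e. `(Ĝ + εI)p_a + p_b = η_a𝟙`, `p_a + (Ĝ + (ε+1)I)p_b = η_b𝟙` — and `|p_a| = |p_b| = 0`: both `Q`-supports have EVEN size
(sum the rows with `𝟙ᵀĜ = 𝟙ᵀ`).  These are the `I₀*` relations at the twisting primes (Mazur–Rubin Lemma 2.10/2.11) written
in the symbols of `Q`. [cite: SilvermanAEC2009, Prop. X.1.4, Prop. X.4.9] [cite: MazurRubin2010, Lemma 2.10, Lemma 2.11]
[cite: Kane2013SelmerTwists, §2] -/
theorem rows_of_mem_selmerGroup_twist_isoClass (h : E.toAffine.SplitTwoTorsion e₁ e₂ e₃) (hS : ∀ ℓ ∈ S, ℓ.Prime)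
    (hgood : ∀ ℓ : ℕ, (hℓ : ℓ.Prime) → ℓ ∉ S → haveI : Fact ℓ.Prime := ⟨hℓ⟩;
      padicValRat ℓ (e₁ - e₂) = 0 ∧ padicValRat ℓ (e₁ - e₃) = 0 ∧ padicValRat ℓ (e₂ - e₃) = 0)
    (hQ : ∀ q ∈ Q, q.Prime) (hQS : ∀ q ∈ Q, q ∉ S) (hQ4 : ∀ q ∈ Q, q % 4 = 3) (hk : Even Q.card)
    (hiso8 : ∀ q ∈ Q, ∀ q' ∈ Q, q % 8 = q' % 8)
    (hisoS : ∀ q ∈ Q, ∀ q' ∈ Q, ∀ ℓ ∈ S, (hℓ : ℓ.Prime) → ℓ ≠ 2 → haveI : Fact ℓ.Prime := ⟨hℓ⟩;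
      legendreSym ℓ ((q : ℤ) * q') = 1)
    (hadm : ∀ q ∈ Q, (hq : q.Prime) → haveI : Fact q.Prime := ⟨hq⟩;
      qrBit q ((e₁ - e₂) * (e₁ - e₃)) = 1 ∧ qrBit q ((e₂ - e₁) * (e₂ - e₃)) = 1)
    {ε : ZMod 2} (hε : ∀ q ∈ Q, (hq : q.Prime) → haveI : Fact q.Prime := ⟨hq⟩; qrBit q (e₂ - e₁) = ε)
    {d : ℚ} (hd : d = ∏ q ∈ Q, (q : ℚ)) [(E.quadraticTwist d).IsElliptic]
    {c : galH1Torsion (E.quadraticTwist d) 2} (hc : c ∈ selmerGroup (E.quadraticTwist d) 2) (a b : ℚˣ)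
    (ha : kummerEquiv ℚ 2 ((E.quadraticTwist d).twoTorsionCharH1 (h.quadraticTwist d) c) =
      Additive.ofMul (QuotientGroup.mk a))
    (hb : kummerEquiv ℚ 2 ((E.quadraticTwist d).twoTorsionCharH1 (h.quadraticTwist d).swap₁₂ c) =
      Additive.ofMul (QuotientGroup.mk b)) :
    (∑ i ∈ Q, parityBit i (a : ℚ) = 0 ∧ ∑ i ∈ Q, parityBit i (b : ℚ) = 0) ∧
    ∃ ηa ηb : ZMod 2, ∀ j ∈ Q,
      ((∑ i ∈ Q.erase j, (if jacobiSym (-(i : ℤ)) j = -1 then (1 : ZMod 2) else 0) * parityBit i (a : ℚ)) +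
          ((∑ i ∈ Q.erase j, (if jacobiSym (-(i : ℤ)) j = -1 then (1 : ZMod 2) else 0)) + ε) * parityBit j (a : ℚ) +
          parityBit j (b : ℚ) = ηa) ∧
      ((∑ i ∈ Q.erase j, (if jacobiSym (-(i : ℤ)) j = -1 then (1 : ZMod 2) else 0) * parityBit i (b : ℚ)) +
          ((∑ i ∈ Q.erase j, (if jacobiSym (-(i : ℤ)) j = -1 then (1 : ZMod 2) else 0)) + ε + 1) * parityBit j (b : ℚ) +
          parityBit j (a : ℚ) = ηb) := by
  -- kernels of the two components
  obtain ⟨ma, -, -, -, -, hηa, hrowa⟩ := exists_intKernel_of_mem_selmerGroup_twist_isoClass E S Q h hS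
    (fun ℓ hℓ hℓS => ⟨(hgood ℓ hℓ hℓS).1, (hgood ℓ hℓ hℓS).2.1⟩) hQ hQS hQ4 hiso8 hisoS hd hc a ha
  obtain ⟨mb, -, -, -, -, hηb, hrowb⟩ := exists_intKernel_of_mem_selmerGroup_twist_isoClass E S Q h.swap₁₂ hS
    (fun ℓ hℓ hℓS => ⟨by rw [← neg_sub, padicValRat.neg]; exact (hgood ℓ hℓ hℓS).1, (hgood ℓ hℓ hℓS).2.2⟩)
    hQ hQS hQ4 hiso8 hisoS hd hc b hb
  by_cases hQe : Q = ∅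
  · subst hQe; simp
  obtain ⟨q₀, hq₀⟩ := Finset.nonempty_iff_ne_empty.mpr hQe
  haveI hq₀F : Fact q₀.Prime := ⟨hQ q₀ hq₀⟩
  subst hd
  have hQ0 : ∀ q ∈ Q, (q : ℚ) ≠ 0 := fun q hq => by exact_mod_cast (hQ q hq).ne_zero
  have he12 : e₁ - e₂ ≠ 0 := sub_ne_zero.mpr h.ne₁₂
  have he21 : e₂ - e₁ ≠ 0 := sub_ne_zero.mpr h.ne₁₂.symm
  -- the row relations WITH the support sizes on the right
  have hrows : ∀ j ∈ Q,
      ((∑ i ∈ Q.erase j, (if jacobiSym (-(i : ℤ)) j = -1 then (1 : ZMod 2) else 0) * parityBit i (a : ℚ)) +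
          ((∑ i ∈ Q.erase j, (if jacobiSym (-(i : ℤ)) j = -1 then (1 : ZMod 2) else 0)) + ε) * parityBit j (a : ℚ) +
          parityBit j (b : ℚ) = qrBit q₀ (ma : ℚ) + ∑ i ∈ Q, parityBit i (a : ℚ)) ∧
      ((∑ i ∈ Q.erase j, (if jacobiSym (-(i : ℤ)) j = -1 then (1 : ZMod 2) else 0) * parityBit i (b : ℚ)) +
          ((∑ i ∈ Q.erase j, (if jacobiSym (-(i : ℤ)) j = -1 then (1 : ZMod 2) else 0)) + ε + 1) * parityBit j (b : ℚ) +
          parityBit j (a : ℚ) = qrBit q₀ (mb : ℚ) + ∑ i ∈ Q, parityBit i (b : ℚ)) := by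
    intro j hj
    haveI : Fact j.Prime := ⟨hQ j hj⟩
    have hjS : j ∉ S := hQS j hj
    obtain ⟨g12, g13, g23⟩ := hgood j (hQ j hj) hjS
    have hvd : padicValRat j (∏ q ∈ Q, (q : ℚ)) = 1 := by rw [padicValRat_prod_primes hQ j, if_pos hj]
    obtain ⟨r1, r2⟩ := E.qrBit_rel_quadraticTwist_of_mem_selmerGroup h hvd g12 g13 g23 hc a b ha hb
    obtain ⟨hδ₁, hδ₂⟩ := hadm j hj (hQ j hj)
    have hεj := hε j hj (hQ j hj)
    have hε' : qrBit j (e₁ - e₂) = 1 + ε := by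
      rw [← neg_sub, qrBit_neg (p := j) he21, qrBit_neg_one_eq_one_of_emod_four (hQ4 j hj), hεj]
    have hqd : qrBit j (∏ q ∈ Q, (q : ℚ)) =
        1 + ∑ i ∈ Q.erase j, (if jacobiSym (-(i : ℤ)) j = -1 then (1 : ZMod 2) else 0) := by
      rw [qrBit_prod_natCast_eq Q hQ (hQ4 j hj) (subset_refl Q), card_erase_cast_eq_one hk hj]
    rw [hδ₁, hεj, hqd, hrowa j hj (hQ j hj), hηa j hj q₀ hq₀ (hQ j hj) hq₀F.out] at r1
    rw [hδ₂, hε', hqd, hrowb j hj (hQ j hj), hηb j hj q₀ hq₀ (hQ j hj) hq₀F.out] at r2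
    -- split `Σ_{i≠j} (1 + G j i) p(i) = Σ_{i≠j} p(i) + Σ_{i≠j} G j i p(i)` and `Σ_{i≠j} p(i) = |p| + p(j)`
    have hsplit : ∀ (x : ℚ), (∑ i ∈ Q.erase j,
        (1 + (if jacobiSym (-(i : ℤ)) j = -1 then (1 : ZMod 2) else 0)) * parityBit i x) =
        (∑ i ∈ Q, parityBit i x) + parityBit j x +
          ∑ i ∈ Q.erase j, (if jacobiSym (-(i : ℤ)) j = -1 then (1 : ZMod 2) else 0) * parityBit i x := by
      intro x
      simp only [add_mul, one_mul, Finset.sum_add_distrib]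
      rw [← Finset.sum_erase_add Q (fun i => parityBit i x) hj, add_assoc (∑ i ∈ Q.erase j, parityBit i x),
        CharTwo.add_self_eq_zero, add_zero]
    rw [hsplit] at r1 r2
    constructor
    · -- first row: `η + (|p_a| + p_a j + Σ G p_a) = p_a j (1 + g + ε) + p_b j`, rearranged in characteristic `2`
      linear_combination (norm := skip) r1
      ring_nf
      try reduce_mod_char
      try simp
    · linear_combination (norm := skip) r2
      ring_nf
      try reduce_mod_char
      try simp
  -- summing the rows: `|p_a| + ε|p_a| + |p_b| = 0` and `|p_b| + (ε+1)|p_b| + |p_a| = 0`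
  have hsum : ∀ m : ℕ → ZMod 2,
      (∑ j ∈ Q, ∑ i ∈ Q.erase j, (if jacobiSym (-(i : ℤ)) j = -1 then (1 : ZMod 2) else 0) * m i) +
        (∑ j ∈ Q, (∑ i ∈ Q.erase j, (if jacobiSym (-(i : ℤ)) j = -1 then (1 : ZMod 2) else 0)) * m j) = ∑ j ∈ Q, m j := by
    intro m
    rw [← Finset.sum_add_distrib]
    exact sum_laplacian_apply_eq_sum Q hQ hQ4 hk m
  have hSa : (∑ j ∈ Q, parityBit j (a : ℚ)) + ε * (∑ j ∈ Q, parityBit j (a : ℚ)) + ∑ j ∈ Q, parityBit j (b : ℚ) = 0 := by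
    have htot := Finset.sum_congr rfl fun j hj => (hrows j hj).1
    rw [sum_const_eq_zero_of_even hk] at htot
    simp only [add_mul, Finset.sum_add_distrib, ← Finset.mul_sum] at htot
    linear_combination htot - hsum (fun i => parityBit i (a : ℚ))
  have hSb : (∑ j ∈ Q, parityBit j (b : ℚ)) + (ε + 1) * (∑ j ∈ Q, parityBit j (b : ℚ)) +
      ∑ j ∈ Q, parityBit j (a : ℚ) = 0 := by
    have htot := Finset.sum_congr rfl fun j hj => (hrows j hj).2
    rw [sum_const_eq_zero_of_even hk] at htot
    simp only [add_mul, Finset.sum_add_distrib, ← Finset.mul_sum] at htot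
    linear_combination htot - hsum (fun i => parityBit i (b : ℚ))
  have heven : ∑ i ∈ Q, parityBit i (a : ℚ) = 0 ∧ ∑ i ∈ Q, parityBit i (b : ℚ) = 0 := by
    rcases zmod2_cases ε with hε' | hε' <;>
      rcases zmod2_cases (∑ i ∈ Q, parityBit i (a : ℚ)) with hA | hA <;>
      rcases zmod2_cases (∑ i ∈ Q, parityBit i (b : ℚ)) with hB | hB <;>
      simp only [hε', hA, hB] at hSa hSb ⊢ <;> revert hSa hSb <;> decide
  refine ⟨heven, qrBit q₀ (ma : ℚ), qrBit q₀ (mb : ℚ), fun j hj => ?_⟩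
  obtain ⟨r1, r2⟩ := hrows j hj
  rw [heven.1, add_zero] at r1
  rw [heven.2, add_zero] at r2
  exact ⟨r1, r2⟩

end Rows

end Summit.BirchSwinnertonDyer.BirchSwinnertonDyer.Theorems.GenusKolyvaginAtTwo.TorsionCellSEL

end
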